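import Summits.CriticalPhenomena.PercolationContinuityZ3.Theorems.PercNearOneGluingNoHeavyLowerTailSahiCombTriWGenU

/-!
# The three-family functional is SYMMETRIC under exchanging the two cubes: `triWGen U F G = triWGen Fᵀ Uᵀ Gᵀ`

Support file of the one-cut programme (crux `NoHeavyLowerTail`, stmt-CriticalPhenomena-4575; cell `prim-masterthm`, seat P5 gen 18;
memo `FROM-prim-masterthm-p5-g18-SYMMETRIC-MASTER-FORM.md` §1).

A family `U : Finset β → Finset (Finset γ)` is an up-set of the product cube `Finset β × Finset γ`; its TRANSPOSE is the family
`idxSet U : Finset γ → Finset (Finset β)`, `idxSet U w = {x | w ∈ U x}` (`…SahiCombTriWShell`), i.e. the same up-set read with the roles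
of the two cubes exchanged.  The three-family functional `triWGen` of `…SahiCombTriWGenU` (whose constant-middle-family case is the tree's
`triW`) satisfies

  **`triWGen U F G = triWGen (idxSet F) (idxSet U) (idxSet G)`**   (`triWGen_transpose`)

— exchanging the index cube `Finset β` and the cube `Finset γ` TOGETHER WITH the first two families leaves it invariant (double counting
of the five summands; the third and fourth summands trade places, the fifth is re-indexed by `(x,w) ↦ (xᶜ,wᶜ)`).  Consequences: the
cylinder hypothesis of `TriWIneq` ("the first up-set ignores the index block") is the same as "the middle up-set ignores the OTHER block";
the cells `(a,n)` and `(n,a)` of the census are one statement; `TriWGenIneq` for index cubes `β` and cubes `γ` is equivalent to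
`TriWGenIneq` for index cubes `γ` and cubes `β` (`triWGen_nonneg_transpose_iff`).

* `FiveUpSet.sum_card_univFilter_swap` — generic double counting `Σ_x #{w | R x w} = Σ_w #{x | R x w}`;
* `FiveUpSet.idxSet_mono_of_upper`, `FiveUpSet.isUpperSet_idxSet'` — the transpose of a monotone family of up-sets is a monotone family of up-sets;
* **`FiveUpSet.triWGen_transpose`**, `FiveUpSet.triWGen_nonneg_transpose_iff`.
HONEST LABEL: identities only; nothing here proves `TriWIneq`. [this work]
-/

namespace Summit.CriticalPhenomena.PercolationContinuityZ3.Theorems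

namespace FiveUpSet

open Finset

variable {β γ : Type} [DecidableEq β] [Fintype β] [DecidableEq γ] [Fintype γ]

omit [DecidableEq β] [DecidableEq γ] in
/-- Generic double counting over the product of the two cubes: `Σ_x #{w | R x w} = Σ_w #{x | R x w}`. [folklore] -/
theorem sum_card_univFilter_swap (R : Finset β → Finset γ → Prop) [∀ x w, Decidable (R x w)] :
    ∑ x : Finset β, ((univ.filter (fun w => R x w)).card : ℤ) = ∑ w : Finset γ, ((univ.filter (fun x => R x w)).card : ℤ) := by
  have h1 : ∀ x : Finset β, ((univ.filter (fun w => R x w)).card : ℤ) = ∑ w : Finset γ, (if R x w then (1 : ℤ) else 0) := by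
    intro x; rw [Finset.sum_boole]
  have h2 : ∀ w : Finset γ, ((univ.filter (fun x => R x w)).card : ℤ) = ∑ x : Finset β, (if R x w then (1 : ℤ) else 0) := by
    intro w; rw [Finset.sum_boole]
  simp only [h1, h2]
  exact Finset.sum_comm

omit [DecidableEq β] [Fintype γ] in
/-- The transpose of a monotone family is up-set valued. [this work] -/
theorem isUpperSet_idxSet' {U : Finset β → Finset (Finset γ)} (hUm : Monotone U) (w : Finset γ) :
    IsUpperSet (idxSet U w : Set (Finset β)) :=
  isUpperSet_idxSet hUm w

omit [DecidableEq β] [Fintype γ] in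
/-- The transpose of an up-set-valued family is monotone. [this work] -/
theorem idxSet_mono_of_upper {U : Finset β → Finset (Finset γ)} (hU : ∀ x, IsUpperSet (U x : Set (Finset γ))) :
    Monotone (idxSet U) := by
  intro w w' hww' x hx
  rw [mem_idxSet] at hx ⊢
  exact hU x hww' hx

/-- **Transposition symmetry of the three-family functional**: `triWGen U F G = triWGen (idxSet F) (idxSet U) (idxSet G)`
(index cube and cube exchanged, first two families exchanged). [this work] -/
theorem triWGen_transpose (U F G : Finset β → Finset (Finset γ)) :
    triWGen U F G = triWGen (idxSet F) (idxSet U) (idxSet G) := by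
  -- the five summand totals
  have e1 : ∑ x : Finset β, ((U x ∩ F x ∩ G x).card : ℤ)
      = ∑ w : Finset γ, ((idxSet F w ∩ idxSet U w ∩ idxSet G w).card : ℤ) := by
    have hl : ∑ x : Finset β, ((U x ∩ F x ∩ G x).card : ℤ)
        = ∑ x : Finset β, ((univ.filter (fun w : Finset γ => w ∈ U x ∧ w ∈ F x ∧ w ∈ G x)).card : ℤ) :=
      sum_congr rfl fun x _ => by congr 2; ext w; simp
    have hr : ∑ w : Finset γ, ((idxSet F w ∩ idxSet U w ∩ idxSet G w).card : ℤ)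
        = ∑ w : Finset γ, ((univ.filter (fun x : Finset β => w ∈ U x ∧ w ∈ F x ∧ w ∈ G x)).card : ℤ) :=
      sum_congr rfl fun w _ => by congr 2; ext x; simp [and_left_comm]
    rw [hl, hr]
    exact sum_card_univFilter_swap (fun (x : Finset β) (w : Finset γ) => w ∈ U x ∧ w ∈ F x ∧ w ∈ G x)
  have e2 : ∑ x : Finset β, ((U x ∩ F x ∩ refl (G xᶜ)).card : ℤ)
      = ∑ w : Finset γ, ((idxSet F w ∩ idxSet U w ∩ refl (idxSet G wᶜ)).card : ℤ) := by
    have hl : ∑ x : Finset β, ((U x ∩ F x ∩ refl (G xᶜ)).card : ℤ)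
        = ∑ x : Finset β, ((univ.filter (fun w : Finset γ => w ∈ U x ∧ w ∈ F x ∧ wᶜ ∈ G xᶜ)).card : ℤ) :=
      sum_congr rfl fun x _ => by congr 2; ext w; simp [mem_refl]
    have hr : ∑ w : Finset γ, ((idxSet F w ∩ idxSet U w ∩ refl (idxSet G wᶜ)).card : ℤ)
        = ∑ w : Finset γ, ((univ.filter (fun x : Finset β => w ∈ U x ∧ w ∈ F x ∧ wᶜ ∈ G xᶜ)).card : ℤ) :=
      sum_congr rfl fun w _ => by congr 2; ext x; simp [and_left_comm, mem_refl]
    rw [hl, hr]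
    exact sum_card_univFilter_swap (fun (x : Finset β) (w : Finset γ) => w ∈ U x ∧ w ∈ F x ∧ wᶜ ∈ G xᶜ)
  have e3 : ∑ x : Finset β, ((refl (U xᶜ) ∩ F x ∩ G x).card : ℤ)
      = ∑ w : Finset γ, ((idxSet F w ∩ refl (idxSet U wᶜ) ∩ idxSet G w).card : ℤ) := by
    have hl : ∑ x : Finset β, ((refl (U xᶜ) ∩ F x ∩ G x).card : ℤ)
        = ∑ x : Finset β, ((univ.filter (fun w : Finset γ => wᶜ ∈ U xᶜ ∧ w ∈ F x ∧ w ∈ G x)).card : ℤ) :=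
      sum_congr rfl fun x _ => by congr 2; ext w; simp [mem_refl]
    have hr : ∑ w : Finset γ, ((idxSet F w ∩ refl (idxSet U wᶜ) ∩ idxSet G w).card : ℤ)
        = ∑ w : Finset γ, ((univ.filter (fun x : Finset β => wᶜ ∈ U xᶜ ∧ w ∈ F x ∧ w ∈ G x)).card : ℤ) :=
      sum_congr rfl fun w _ => by congr 2; ext x; simp [and_left_comm, mem_refl]
    rw [hl, hr]
    exact sum_card_univFilter_swap (fun (x : Finset β) (w : Finset γ) => wᶜ ∈ U xᶜ ∧ w ∈ F x ∧ w ∈ G x)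
  have e4 : ∑ x : Finset β, ((U x ∩ refl (F xᶜ) ∩ G x).card : ℤ)
      = ∑ w : Finset γ, ((refl (idxSet F wᶜ) ∩ idxSet U w ∩ idxSet G w).card : ℤ) := by
    have hl : ∑ x : Finset β, ((U x ∩ refl (F xᶜ) ∩ G x).card : ℤ)
        = ∑ x : Finset β, ((univ.filter (fun w : Finset γ => w ∈ U x ∧ wᶜ ∈ F xᶜ ∧ w ∈ G x)).card : ℤ) :=
      sum_congr rfl fun x _ => by congr 2; ext w; simp [mem_refl]
    have hr : ∑ w : Finset γ, ((refl (idxSet F wᶜ) ∩ idxSet U w ∩ idxSet G w).card : ℤ)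
        = ∑ w : Finset γ, ((univ.filter (fun x : Finset β => w ∈ U x ∧ wᶜ ∈ F xᶜ ∧ w ∈ G x)).card : ℤ) :=
      sum_congr rfl fun w _ => by congr 2; ext x; simp [and_left_comm, mem_refl]
    rw [hl, hr]
    exact sum_card_univFilter_swap (fun (x : Finset β) (w : Finset γ) => w ∈ U x ∧ wᶜ ∈ F xᶜ ∧ w ∈ G x)
  -- the fifth summand: double counting after the re-indexing `(x,w) ↦ (xᶜ,wᶜ)`
  have e5a : ∑ x : Finset β, ((U x ∩ refl (F xᶜ) ∩ G xᶜ).card : ℤ)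
      = ∑ w : Finset γ, ((univ.filter (fun x : Finset β => w ∈ U x ∧ wᶜ ∈ F xᶜ ∧ w ∈ G xᶜ)).card : ℤ) := by
    have hl : ∑ x : Finset β, ((U x ∩ refl (F xᶜ) ∩ G xᶜ).card : ℤ)
        = ∑ x : Finset β, ((univ.filter (fun w : Finset γ => w ∈ U x ∧ wᶜ ∈ F xᶜ ∧ w ∈ G xᶜ)).card : ℤ) :=
      sum_congr rfl fun x _ => by congr 2; ext w; simp [mem_refl]
    rw [hl]
    exact sum_card_univFilter_swap (fun (x : Finset β) (w : Finset γ) => w ∈ U x ∧ wᶜ ∈ F xᶜ ∧ w ∈ G xᶜ)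
  have e5b : ∀ w : Finset γ, ((idxSet F w ∩ refl (idxSet U wᶜ) ∩ idxSet G wᶜ).card : ℤ)
      = ((univ.filter (fun x : Finset β => wᶜ ∈ U x ∧ wᶜᶜ ∈ F xᶜ ∧ wᶜ ∈ G xᶜ)).card : ℤ) := by
    intro w
    -- the filter on the right is the antipodal image of the set on the left
    rw [← card_refl (idxSet F w ∩ refl (idxSet U wᶜ) ∩ idxSet G wᶜ)]
    congr 2
    ext x
    simp [mem_refl, and_left_comm, compl_compl]
  have e5 : ∑ x : Finset β, ((U x ∩ refl (F xᶜ) ∩ G xᶜ).card : ℤ)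
      = ∑ w : Finset γ, ((idxSet F w ∩ refl (idxSet U wᶜ) ∩ idxSet G wᶜ).card : ℤ) := by
    rw [e5a]
    simp only [e5b]
    exact Fintype.sum_equiv (complEquiv γ) _ _ (fun w => by simp [complEquiv, compl_compl])
  unfold triWGen triWGenTerm
  simp only [sum_add_distrib, sum_sub_distrib, ← mul_sum]
  rw [e1, e2, e3, e4, e5]
  ring

/-- `TriWGenIneq` is symmetric in the two cubes: the functional of a triple of monotone up-set families over `(β, γ)` is the functional
of the transposed triple over `(γ, β)`; so `0 ≤ triWGen U F G ↔ 0 ≤ triWGen (idxSet F) (idxSet U) (idxSet G)`. [this work] -/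
theorem triWGen_nonneg_transpose_iff (U F G : Finset β → Finset (Finset γ)) :
    0 ≤ triWGen U F G ↔ 0 ≤ triWGen (idxSet F) (idxSet U) (idxSet G) := by
  rw [triWGen_transpose]

end FiveUpSet

end Summit.CriticalPhenomena.PercolationContinuityZ3.Theorems
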